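import Summits.BirchSwinnertonDyer.BirchSwinnertonDyer.Theorems.ErratumRoadFiveNonSurjCornerHybridTwinMuAnDeep
import HarnessLib

/-!
# Route `ErratumRoadFive` (rung K2), crux `NonSurjCorner` (item stmt-BirchSwinnertonDyer-19065): THE PHASE-1b GLUE ITEM `NonSurjCornerOfItems`
# (SHAPE B, RULING 68) CLOSED MODULO THE SIX TOP-LEVEL ITEMS IT CONSUMES — proof-of-item one-liner over `nonSurjCornerOfItemsDeep_holds` (p642519)
# (cell `bsd-stepL`, seat `bsd-stepL-corner-p1` g18; `--workitem stmt-BirchSwinnertonDyer-23049`)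

The generated glue of the SHAPE-B re-split (gen 3, rev 56+; glue item stmt-BirchSwinnertonDyer-23049) reads `NonSurjCornerOfItems :
NonSurjCornerKolyZDeep → NonSurjCornerTwinMuAnDeep → KatoTwinFactsFiveAnContra → NonSurjCorner` (route decls; the first two are aliases BY NAME of the
Theses-free constants of `…NonSurjCornerDeepChildrenDefs` (items 23046, 23047), the third is the fifteen-fact bundle BY TEXT (item 23048); NO alias
child for `X11aLowerHalf` this generation — it enters as the top-level item 19064). Its proof modulo the top-level items {`PublishedInputsFive` (19066),
`X11aLowerHalf` (19064), `EulerHalfGrossPrintFacts` (27981), `ShimuraParametrizationDataNonempty` (19524), `PastenComponentOrdersInput` (19716),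
`ShimuraCasselsTateLevelInputs` (20191), `ShimuraCarrierLabelsB6FromFive` (27982)} is this seat's `nonSurjCornerOfItemsDeep_holds` (p642519); every
decl unfolds definitionally. HONEST FRAMING: ONE THEOREM; CONDITIONAL on seven route items and, inside the glue, on the three children (OPEN
mathematics in the two deep children, in 19064 and in 27982; printed inputs elsewhere); closing the glue item is a registry act; BSD is not advanced; T7.
[cite: Cha2005, Thm. 21 and Rmk. 25] [cite: Kato2004Asterisque, Thm. 12.4, §17.13] [cite: PastenShimura2024, Lemma 6.18] [cite: Miller2011LMS, Def. 1.1]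
-/

set_option autoImplicit false
set_option linter.dupNamespace false -- `Summit.BirchSwinnertonDyer.BirchSwinnertonDyer` (summit = problem), tree-wide

noncomputable section

namespace Summit.BirchSwinnertonDyer.BirchSwinnertonDyer.Theorems

open Summit.BirchSwinnertonDyer.BirchSwinnertonDyer.Theses.ErratumRoadFive

/-- **The SHAPE-B glue `NonSurjCornerOfItems` (item 23049) modulo the seven top-level items it consumes** (RULING 68 (b)'s one-liner): binders
`PublishedInputsFive`, `X11aLowerHalf`, `EulerHalfGrossPrintFacts`, `ShimuraParametrizationDataNonempty`, `PastenComponentOrdersInput`,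
`ShimuraCasselsTateLevelInputs`, `ShimuraCarrierLabelsB6FromFive`; conclusion the glue decl BY NAME; proof `nonSurjCornerOfItemsDeep_holds` (p642519).
CONDITIONAL; T7. [cite: Miller2011LMS, Def. 1.1] [cite: Cha2005, Thm. 21 and Rmk. 25] -/
theorem nonSurjCornerOfItems_of_items
    (h₅ : PublishedInputsFive) (h₃ : X11aLowerHalf) (hF2 : EulerHalfGrossPrintFacts)
    (hJL : ShimuraParametrizationDataNonempty) (hCO : PastenComponentOrdersInput) (hCTi : ShimuraCasselsTateLevelInputs)
    (hLab : ShimuraCarrierLabelsB6FromFive) :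
    NonSurjCornerOfItems :=
  fun hZ hμ hF ↦ nonSurjCornerOfItemsDeep_holds h₅ h₃ hF2 hJL hCO hCTi hLab hZ hμ hF

end Summit.BirchSwinnertonDyer.BirchSwinnertonDyer.Theorems

end
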